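import Summits.CriticalPhenomena.CardyFormulaZ2.Theorems.CardyUSTContinuationKirchhoffExtremalLengthG02Dual9
import Summits.CriticalPhenomena.CardyFormulaZ2.Theorems.CardyUSTContinuationKirchhoffExtremalLengthConductanceBound
import Literature.Probability.LatticeModels.SquareTilingModulusLiminf

/-!
# The conjugate near a boundary point is close to the virtual value of a nearby exit
# (quantitative form, G02 discretisation)

Support file for `KirchhoffExtremalLength` (route CardyUSTContinuation of `CardyFormulaZ2`, item
stmt-CriticalPhenomena-11234), towards the upper half of `G02ModulusConvergence` (`…Defs.lean`):
the box arithmetic turning the weak-Beurling estimate for the discrete conjugate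
`abs_facePot_sub_faceExitVal_le` into the form used for the boundary values of the limit of the
conjugates (the tree's `SquareTiling.exists_boundary_value`, inner estimate `hkey`): at a face of
the component whose mesh point is within `θ r_a / 100` of the boundary point `q`, the conjugate
differs from the virtual value of any exit within `r_a / 40 + 5δ` of `q` by at most
`(1 + 8 √E) K_B θ^α`.
-/

noncomputable section

namespace Summit.CriticalPhenomena.CardyFormulaZ2.Theorems

namespace KirchhoffSlope

open Set Metric Filter Topology SimpleGraph
open Literature.Probability Literature.Probability.LatticeModels Literature.Probability.Percolation
open Literature.Probability.LatticeModels.SquareTiling (closedSq floorSq mem_closedSq_floorSq meshPoint_mem_closedSq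
  dist_le_of_mem_closedSq)
open Literature.Probability.RandomPlanarGeometry

variable {δ : ℝ}

open WeakBeurling

open Classical in
/-- **The conjugate near `q` is close to the virtual value of a nearby exit** (quantitative; cf.
the estimate `hkey` in the tree's `SquareTiling.exists_boundary_value`). Hypotheses: the
potential `h` (values in `[0,1]`, harmonic off the discrete arcs, real energy `≤ E`), the base
face `p₀`, the boundary point `q = boundary s₀` at distance `≥ ε + 3δ` from the mesh points of the
discrete arcs, radii `ρ ≤ ε` of `JordanDomain.exists_joinedIn_exterior_diff_closedBall` and `r_a`
of `exists_ulc_radius` (`r_a + 3δ ≤ ρ - 4δ`, `δ < r_a / 200`), an exit `(p₁, n₁)` of the component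
with `p₁` within `r_a/40 + 5δ` of `q`, an exterior point `e` within `δ/2` of `q`, and a face `z`
of the component with mesh point within `θ r_a / 100` of `q`, `0 < θ ≤ 1`. Then
`|facePot z - E(p₁, n₁)| ≤ (1 + 8 √E) K_B θ^α`. [cite: GeorgakopoulosPanagiotis2019, §3 and Lemma 4.8 (dual form)] -/
theorem abs_facePot_sub_faceExitVal_le_of_near (R : ConformalRectangle) (hδ : 0 < δ) {h : Site 2 → ℝ}
    (hharm : ∀ x, x ∉ discreteArc R.carrier δ (R.arc 0) → x ∉ discreteArc R.carrier δ (R.arc 2) →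
      ∑ y ∈ ((zdGraph 2).neighborFinset x).filter (fun y => (discreteDomainGraph R.carrier δ).Adj x y), (h y - h x) = 0)
    (h01 : ∀ x, h x ∈ Icc (0 : ℝ) 1) {p₀ : Site 2} (hp₀ : IsInnerFace R.carrier δ p₀) {E : ℝ}
    (hE : ∑ e ∈ (edgeSet_discreteDomainGraph_finite R.isBounded hδ).toFinset, sqIncr h e ≤ E)
    {s₀ ε ρ ra : ℝ} (hε : 0 < ε) (hρε : ρ ≤ ε)
    (hρ : ∀ e y : ℂ, e ∈ (closure R.carrier)ᶜ → y ∈ (closure R.carrier)ᶜ →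
      ε ≤ dist e (R.boundary s₀) → ε ≤ dist y (R.boundary s₀) →
      JoinedIn ((closure R.carrier)ᶜ \ closedBall (R.boundary s₀) ρ) e y)
    (hulc : ∀ e₁ e₂ : ℂ, e₁ ∈ (closure R.carrier)ᶜ → e₂ ∈ (closure R.carrier)ᶜ →
      dist e₁ (R.boundary s₀) < ra + 3 * δ → dist e₂ (R.boundary s₀) < ra + 3 * δ →
      JoinedIn ((closure R.carrier)ᶜ ∩ ball (R.boundary s₀) (ρ - 4 * δ)) e₁ e₂)
    (hraρ : ra + 3 * δ ≤ ρ - 4 * δ)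
    (hfar : ∀ x ∈ discreteArc R.carrier δ (R.arc 0) ∪ discreteArc R.carrier δ (R.arc 2),
      ε + 3 * δ ≤ dist (meshPoint δ x) (R.boundary s₀))
    (hra : 0 < ra) (hδra : δ < ra / 200)
    {p₁ n₁ : Site 2} (hp₁F : (faceGraph R.carrier δ).Reachable p₀ p₁) (hadj₁ : (zdGraph 2).Adj p₁ n₁)
    (hn₁F : ¬ (faceGraph R.carrier δ).Reachable p₀ n₁)
    (hp₁near : ∀ w ∈ closedSq δ p₁, dist w (R.boundary s₀) ≤ ra / 40 + 5 * δ)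
    {e : ℂ} (he : e ∈ (closure R.carrier)ᶜ) (heq : dist e (R.boundary s₀) < δ / 2)
    {θ : ℝ} (hθ : 0 < θ) (hθ1 : θ ≤ 1) (hδθ : δ < θ * ra / 100) {z : Site 2} (hzF : (faceGraph R.carrier δ).Reachable p₀ z)
    (hzq : dist (meshPoint δ z) (R.boundary s₀) ≤ θ * ra / 100) :
    |facePot R.carrier δ h p₀ z - faceExitVal R.carrier δ h p₀ p₁ n₁| ≤
      (1 + 8 * Real.sqrt E) * beurlingConst * θ ^ beurlingExp := by
  set q := R.boundary s₀ with hq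
  have hdpos : 0 < δ := hδ
  have hα := beurlingExp_pos
  have hTsub : discreteArc R.carrier δ (R.arc 0) ⊆ meshBoundary R.carrier δ := fun x hx => hx.1
  have hBsub : discreteArc R.carrier δ (R.arc 2) ⊆ meshBoundary R.carrier δ := fun x hx => hx.1
  have hnra : δ < ra / 200 := hδra
  set Rb : ℕ := ⌊ra / (5 * δ)⌋₊ - 6 with hRbdef
  -- the box radius `Rb`
  have hx : 8 ≤ ⌊ra / (5 * δ)⌋₊ := by
    have : (8 : ℝ) ≤ ra / (5 * δ) := by rw [le_div_iff₀ (by positivity)]; linarith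
    exact Nat.le_floor this
  have hRbR : ((Rb : ℕ) : ℝ) = (⌊ra / (5 * δ)⌋₊ : ℝ) - 6 := by
    have : Rb = ⌊ra / (5 * δ)⌋₊ - 6 := rfl
    rw [this, Nat.cast_sub (by omega : 6 ≤ ⌊ra / (5 * δ)⌋₊)]; push_cast; ring
  have hfl1 : (⌊ra / (5 * δ)⌋₊ : ℝ) ≤ ra / (5 * δ) := Nat.floor_le (by positivity)
  have hfl2 : ra / (5 * δ) < (⌊ra / (5 * δ)⌋₊ : ℝ) + 1 := Nat.lt_floor_add_one _
  have hRb1 : 1 ≤ Rb := by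
    have : Rb = ⌊ra / (5 * δ)⌋₊ - 6 := rfl
    rw [this]; omega
  have hxd : ra / (5 * δ) * δ = ra / 5 := by field_simp
  have hflmul : (⌊ra / (5 * δ)⌋₊ : ℝ) * δ ≤ ra / 5 := by
    rw [← hxd]; exact mul_le_mul_of_nonneg_right hfl1 hdpos.le
  have hflmul' : ra / 5 < ((⌊ra / (5 * δ)⌋₊ : ℝ) + 1) * δ := by
    rw [← hxd]; exact mul_lt_mul_of_pos_right hfl2 hdpos
  have hRbup : (Rb : ℝ) * δ ≤ ra / 5 - 6 * δ := by rw [hRbR, sub_mul]; linarith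
  have hRblo : ra / 5 - 7 * δ < (Rb : ℝ) * δ := by rw [hRbR, sub_mul]; linarith
  have hbox : 2 * (2 * (Rb : ℝ) + 10) * δ < ra := by
    have e : 2 * (2 * (Rb : ℝ) + 10) * δ = 4 * ((Rb : ℝ) * δ) + 20 * δ := by ring
    rw [e]; linarith
  -- the canonical exit is in the big box about `q`
  have hmpq : dist q (meshPoint δ (floorSq δ q)) ≤ 2 * δ :=
    dist_le_of_mem_closedSq (mem_closedSq_floorSq hdpos q) (meshPoint_mem_closedSq hdpos.le (Or.inl rfl) (Or.inl rfl))
  have hp₁b : p₁ ∈ sqBox (floorSq δ (R.boundary s₀)) (2 * ((Rb : ℤ) + 3)) := by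
    refine SquareTiling.mem_sqBox_of_dist_le hdpos ?_
    have h1 := hp₁near (meshPoint δ (p₁)) (meshPoint_mem_closedSq hdpos.le (Or.inl rfl) (Or.inl rfl))
    have h2 := dist_triangle (meshPoint δ (p₁)) q (meshPoint δ (floorSq δ q))
    push_cast
    have e : (2 * ((Rb : ℝ) + 3)) * δ = 2 * ((Rb : ℝ) * δ) + 6 * δ := by ring
    rw [e]; linarith
  -- the box about the exterior point `e n`
  set r : ℝ := θ * ra / 100 with hr
  set ρ' : ℕ := ⌈r / δ⌉₊ + 3 with hρ'
  have hce1 : r / δ ≤ (⌈r / δ⌉₊ : ℝ) := Nat.le_ceil _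
  have hce2 : (⌈r / δ⌉₊ : ℝ) < r / δ + 1 := Nat.ceil_lt_add_one (by positivity)
  have hrd : r / δ * δ = r := by field_simp
  have hρ'lo : r + 3 * δ ≤ (ρ' : ℝ) * δ := by
    rw [hρ']; push_cast
    have := mul_le_mul_of_nonneg_right hce1 hdpos.le
    rw [hrd] at this; linarith
  have hρ'hi : (ρ' : ℝ) * δ < r + 4 * δ := by
    rw [hρ']; push_cast
    have := mul_lt_mul_of_pos_right hce2 hdpos
    rw [add_mul, hrd] at this; linarith
  have hmpe : dist e (meshPoint δ (floorSq δ e)) ≤ 2 * δ :=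
    dist_le_of_mem_closedSq (mem_closedSq_floorSq hdpos e) (meshPoint_mem_closedSq hdpos.le (Or.inl rfl) (Or.inl rfl))
  have hzρ : z ∈ sqBox (floorSq δ e) (ρ' : ℤ) := by
    refine SquareTiling.mem_sqBox_of_dist_le hdpos ?_
    have h2 := dist_triangle4 (meshPoint δ z) q e (meshPoint δ (floorSq δ e))
    have h3 := heq
    rw [_root_.dist_comm] at h3
    push_cast
    linarith
  have hzR : z ∈ sqBox (floorSq δ e) (Rb : ℤ) := by
    refine SquareTiling.mem_sqBox_of_dist_le hdpos ?_
    have h2 := dist_triangle4 (meshPoint δ z) q e (meshPoint δ (floorSq δ e))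
    have h3 := heq
    rw [_root_.dist_comm] at h3
    push_cast
    have : r ≤ ra / 100 := by
      have := mul_le_mul_of_nonneg_right hθ1 hra.le
      rw [hr, one_mul] at *; linarith
    linarith
  -- the estimate
  have hmain := abs_facePot_sub_faceExitVal_le R hdpos hTsub hBsub hharm h01 hp₀ hE
    hε hρε hρ hulc hraρ hfar hRb1 (by exact_mod_cast hbox) he heq
    hp₁F hp₁b hadj₁ hn₁F hzF hzρ hzR
  refine hmain.trans ?_
  have hKE0 : 0 ≤ (1 + 8 * Real.sqrt E) * beurlingConst :=
    mul_nonneg (by positivity) beurlingConst_pos.le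
  refine mul_le_mul_of_nonneg_left (Real.rpow_le_rpow (by positivity) ?_ hα.le) hKE0
  -- the ratio of the box radii is at most `θ`
  have hRb10 : ra / 10 ≤ ((Rb : ℝ) + 1) * δ := by
    have e : ((Rb : ℝ) + 1) * δ = (Rb : ℝ) * δ + δ := by ring
    rw [e]; linarith
  rw [div_le_iff₀ (by positivity)]
  have h1 : ((ρ' : ℝ) + 1) * δ < r + 5 * δ := by linarith
  have h2 : θ * (ra / 10) ≤ θ * (((Rb : ℝ) + 1) * δ) := mul_le_mul_of_nonneg_left hRb10 hθ.le
  have h3 : r + 5 * δ ≤ θ * (ra / 10) := by rw [hr]; linarith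
  have h4 : ((ρ' : ℝ) + 1) * δ < (θ * ((Rb : ℝ) + 1)) * δ := by
    calc ((ρ' : ℝ) + 1) * δ < r + 5 * δ := h1
      _ ≤ θ * (ra / 10) := h3
      _ ≤ θ * (((Rb : ℝ) + 1) * δ) := h2
      _ = (θ * ((Rb : ℝ) + 1)) * δ := by ring
  exact (lt_of_mul_lt_mul_right h4 hdpos.le).le

end KirchhoffSlope

end Summit.CriticalPhenomena.CardyFormulaZ2.Theorems
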